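/-
Copyright (c) 2026. All rights reserved.
Released under Apache 2.0 license as described in the file LICENSE.

[NoBLE17] = Fitzner–van der Hofstad, "Generalized approach to the non-backtracking lace expansion",
Probab. Theory Relat. Fields 169 (2017) 1041–1119 (arXiv:1506.07969).  Page numbers below are PTRF pages.
-/
import Literature.Probability.FitznerVanDerHofstad2017.NobleLaplacianBounds
import HarnessLib

/-!
# Total rotational symmetry of the remainders `R_Φ, R_F` of the simplified NoBLE form, by symmetrisation

[NoBLE17] uses, in §3.3.4–3.3.5, that the remainder terms `R_{F,z}`, `R_{Φ,z}` of the simplified form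
`Ĝ_z(k) = Φ̂_z(k)/(1 − F̂_z(k))` (§1.3, (1.8)) are *totally rotationally symmetric* (Def. 2.5, p. 1058): the
displacement bound (3.48) is Lemma 2.12 applied to `R_F`, and the isotropy step (3.83)
`Σ_x |R(x)| x_s² = d⁻¹ Σ_x |R(x)| ‖x‖₂²` is stated for symmetric `R`.  The typed interface
`NobleSimplifiedFormF3At d p B E` (`NobleSimplifiedFormF3.lean`) records the thirteen Assumption-2.7 bounds of
the witnesses `c_Φ, α_Φ, c_F, α_F, R_Φ, R_F` but *not* their symmetry, and the bounds module
`NobleLaplacianBounds` therefore carries `IsTRS R_Φ`, `IsTRS R_F` as hypotheses.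

This module removes that gap WITHOUT touching the App.-D construction of the witnesses: the two-point function
`τ_p` and the step distribution `D` are symmetric under the hyperoctahedral group of `ℤ^d` (signed coordinate
permutations `Site.signedPerm π ε`), so AVERAGING any witness pair `(R_Φ, R_F)` over that finite group gives a
new witness pair which is totally rotationally symmetric and satisfies every conjunct of the form again:
the `k`-space identity `τ̂_p(k)(1 − F̂(k)) = Φ̂(k)` on `[−π,π]^d` (because `τ̂_p`, `D̂` are invariant under the
dual action `k ↦ (ε_i k_{π⁻¹ i})_i`, which preserves the cube, and the identity is affine in `(R̂_Φ, R̂_F)`), the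
value `F̂(0)`, the `ℓ¹` and `‖x‖₂²`-weighted `ℓ¹` bounds (convexity; `‖·‖₂²` is invariant) and the lower bound
`R̂_F(0) − R̂_F(k) ≥ −β̲_{ΔR,F}[1 − D̂(k)]`.

## Contents
* `kAct g k` — the dual action of `g = (π, ε)` on momenta, `kdot_kAct_signedPerm : p(k)·p(x) = k·x`,
  `kAct_mem_cube`, `Dhat_kAct`, `cosFT_comp_signedPerm : (f ∘ p)^(k) = f̂(p(k))`, `tauHat_kAct`;
* `symAvg f` — the group average `x ↦ |G|⁻¹ Σ_g f(g x)`; `isZdSymmetric_symAvg`, `isTRS_symAvg`,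
  `symAvg_weighted_le` (for an invariant weight `w ≥ 0`: `Σ w |symAvg f| ≤ Σ w |f|`, with summability),
  `cosFT_symAvg`, `cosFT_symAvg_zero`;
* `NobleSimplifiedFormF3SymAt d p B E` — the extended simplified form WITH `IsTRS R_Φ ∧ IsTRS R_F`;
  **`NobleSimplifiedFormF3At.symmetrise : NobleSimplifiedFormF3At d p B E → NobleSimplifiedFormF3SymAt d p B E`**
  (no hypothesis), the projections back, `NobleSimplifiedFormF3SymAt.exists_coefficients`;
* **`NobleSimplifiedFormF3At.exists_keyBounds_and_split`** — the interface the `f₃` analysis consumes: from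
  `NobleSimplifiedFormF3At d p B E`, `d ≥ 2`, `p < p_c`, `f₂(p) ≤ Γ₂`, `0 < α̲_F`, `β̲_Δ < α̲_F`, symmetric
  witnesses with all thirteen bounds such that at every `k ∈ [−π,π]^d` with `D̂(k) < 1` the atoms
  `lapAtomsAt d c_Φ α_Φ c_F α_F R_Φ R_F k` satisfy `LapAtoms.KeyBounds (NobleBetaF3.toArgs d B E Γ₂)`,
  `τ̂_p(k) = Ĝ` and `−Δτ̂_p(k) = Ĥ₁ + ⋯ + Ĥ₅` (`NobleLaplacianBounds.keyBounds_and_split`).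

Everything is elementary ([folklore]) apart from the transcribed definitions; no numeral, no dimension.
-/

noncomputable section

namespace Literature.Probability.FitznerVanDerHofstad2017

open MeasureTheory Finset Filter
open scoped BigOperators
open Literature.Probability.LatticeModels
open Literature.Probability.Percolation
open Literature.Barriers.CriticalPhenomena
open Literature.Probability.RandomPlanarGeometry.SAW.Zd (normSq normSq_nonneg)

variable {d : ℕ}

/-! ## A. Signed permutations: parameters, composition, dual action on momenta -/

/-- The parameter set of the hyperoctahedral group of `ℤ^d`: a coordinate permutation and a sign vector
(`Site.signedPerm π ε : x ↦ (ε_i x_{π⁻¹ i})_i`). [cite: FitznerVanDerHofstad2016NoBLE, Def. 2.5 (p. 1058)] -/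
abbrev SymParam (d : ℕ) : Type := Equiv.Perm (Fin d) × (Fin d → ℤˣ)

/-- Composition of signed permutations is a signed permutation:
`p(π,ε) ∘ p(π₀,ε₀) = p(π π₀, ε · (ε₀ ∘ π⁻¹))`. [folklore] -/
theorem signedPerm_signedPerm (π : Equiv.Perm (Fin d)) (ε : Fin d → ℤˣ) (π₀ : Equiv.Perm (Fin d))
    (ε₀ : Fin d → ℤˣ) (x : Site d) :
    Site.signedPerm π ε (Site.signedPerm π₀ ε₀ x) =
      Site.signedPerm (π * π₀) (ε * fun i => ε₀ (π.symm i)) x := by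
  funext i
  simp only [Site.signedPerm_apply, Pi.mul_apply, Units.val_mul, Equiv.Perm.mul_def,
    Equiv.symm_trans_apply, mul_assoc]

/-- Right translation by `g₀ = (π₀, ε₀)` in the hyperoctahedral group, as a bijection of the parameter set:
`(π, ε) ↦ (π π₀, ε · (ε₀ ∘ π⁻¹))`. [folklore] -/
def symCompose (g₀ : SymParam d) : SymParam d ≃ SymParam d :=
  Equiv.prodShear (Equiv.mulRight g₀.1) fun π => Equiv.mulRight fun i => g₀.2 (π.symm i)

/-- `symCompose` realises composition of the maps. [folklore] -/
theorem signedPerm_symCompose (g₀ g : SymParam d) (x : Site d) :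
    Site.signedPerm (symCompose g₀ g).1 (symCompose g₀ g).2 x =
      Site.signedPerm g.1 g.2 (Site.signedPerm g₀.1 g₀.2 x) := by
  obtain ⟨π, ε⟩ := g
  obtain ⟨π₀, ε₀⟩ := g₀
  simp only [symCompose, Equiv.prodShear_apply, Equiv.coe_mulRight, signedPerm_signedPerm]

/-- The dual action on momenta: `kAct (π,ε) k = (ε_i k_{π⁻¹ i})_i`, chosen so that `kAct(k)·p(x) = k·x`.
[folklore] -/
def kAct (g : SymParam d) (k : Fin d → ℝ) : Fin d → ℝ := fun i => ((g.2 i : ℤ) : ℝ) * k (g.1.symm i)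

/-- Unfolding lemma. [folklore] -/
theorem kAct_apply (g : SymParam d) (k : Fin d → ℝ) (i : Fin d) :
    kAct g k i = ((g.2 i : ℤ) : ℝ) * k (g.1.symm i) := rfl

/-- `kAct g 0 = 0`. [folklore] -/
@[simp] theorem kAct_zero (g : SymParam d) : kAct g (0 : Fin d → ℝ) = 0 := by
  funext i; simp [kAct]

/-- `kAct(k) · p(x) = k · x`. [folklore] -/
theorem kdot_kAct_signedPerm (g : SymParam d) (k : Fin d → ℝ) (x : Site d) :
    kdot (kAct g k) (Site.signedPerm g.1 g.2 x) = kdot k x := by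
  obtain ⟨π, ε⟩ := g
  simp only [kdot, kAct, Site.signedPerm_apply, Int.cast_mul]
  have h : ∀ i, ((ε i : ℤ) : ℝ) * k (π.symm i) * (((ε i : ℤ) : ℝ) * ((x (π.symm i) : ℤ) : ℝ)) =
      k (π.symm i) * ((x (π.symm i) : ℤ) : ℝ) := fun i => by
    have hu : ((ε i : ℤ) : ℝ) * ((ε i : ℤ) : ℝ) = 1 := by
      rcases Int.units_eq_one_or (ε i) with h | h <;> simp [h]
    linear_combination (k (π.symm i) * ((x (π.symm i) : ℤ) : ℝ)) * hu
  simp only [h]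
  exact Equiv.sum_comp π.symm (fun j => k j * ((x j : ℤ) : ℝ))

/-- The dual action preserves the cube `[−π,π]^d`. [folklore] -/
theorem kAct_mem_cube (g : SymParam d) {k : Fin d → ℝ} (hk : k ∈ cube d) : kAct g k ∈ cube d := by
  simp only [cube, Set.mem_pi, Set.mem_univ, true_implies, Set.mem_Icc] at hk ⊢
  intro i
  obtain ⟨h1, h2⟩ := hk (g.1.symm i)
  rw [kAct_apply]
  rcases Int.units_eq_one_or (g.2 i) with h | h <;> rw [h] <;> push_cast
  · constructor <;> linarith
  · constructor <;> linarith

/-- `D̂(kAct g k) = D̂(k)` (cosine is even; relabel the coordinates). [folklore] -/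
theorem Dhat_kAct (g : SymParam d) (k : Fin d → ℝ) : Dhat d (kAct g k) = Dhat d k := by
  obtain ⟨π, ε⟩ := g
  simp only [Dhat, kAct]
  congr 1
  have h : ∀ i, Real.cos (((ε i : ℤ) : ℝ) * k (π.symm i)) = Real.cos (k (π.symm i)) := fun i => by
    rcases Int.units_eq_one_or (ε i) with h | h <;> simp [h, Real.cos_neg]
  simp only [h]
  exact Equiv.sum_comp π.symm (fun j => Real.cos (k j))

/-- `(f ∘ p)^(k) = f̂(kAct k)` for the cosine transform. [folklore] -/
theorem cosFT_comp_signedPerm (f : Site d → ℝ) (g : SymParam d) (k : Fin d → ℝ) :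
    cosFT (fun x => f (Site.signedPerm g.1 g.2 x)) k = cosFT f (kAct g k) := by
  simp only [cosFT]
  calc ∑' x, Real.cos (kdot k x) * f (Site.signedPerm g.1 g.2 x)
      = ∑' x, (fun y => Real.cos (kdot (kAct g k) y) * f y) (Site.signedPerm g.1 g.2 x) :=
        tsum_congr fun x => by simp only [kdot_kAct_signedPerm]
    _ = ∑' y, Real.cos (kdot (kAct g k) y) * f y :=
        Equiv.tsum_eq (Site.signedPerm g.1 g.2) (fun y => Real.cos (kdot (kAct g k) y) * f y)

/-- `τ̂_p(kAct g k) = τ̂_p(k)` (total rotational symmetry of `τ_p`). [cite: FitznerVanDerHofstad2016NoBLE, Def. 2.5 (p. 1058)] -/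
theorem tauHat_kAct (p : unitInterval) (g : SymParam d) (k : Fin d → ℝ) :
    tauHat d p (kAct g k) = tauHat d p k := by
  rw [tauHat_eq_cosFT, ← cosFT_comp_signedPerm]
  congr 1
  funext x
  exact isZdSymmetric_tau p g.1 g.2 x

/-- `‖p(x)‖₂² = ‖x‖₂²`. [folklore] -/
theorem normSq_signedPerm (π : Equiv.Perm (Fin d)) (ε : Fin d → ℤˣ) (x : Site d) :
    normSq (Site.signedPerm π ε x) = normSq x := by
  simp only [normSq, Site.signedPerm_apply, Int.cast_mul]
  have h : ∀ i, (((ε i : ℤ) : ℝ) * ((x (π.symm i) : ℤ) : ℝ)) ^ 2 = ((x (π.symm i) : ℤ) : ℝ) ^ 2 := fun i => by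
    have hu : ((ε i : ℤ) : ℝ) * ((ε i : ℤ) : ℝ) = 1 := by
      rcases Int.units_eq_one_or (ε i) with h | h <;> simp [h]
    linear_combination (((x (π.symm i) : ℤ) : ℝ) ^ 2) * hu
  simp only [h]
  exact Equiv.sum_comp π.symm (fun j => ((x j : ℤ) : ℝ) ^ 2)

/-! ## B. The group average -/

/-- The order `2^d d!` of the parameter set is positive. [folklore] -/
theorem card_symParam_pos : 0 < (Fintype.card (SymParam d) : ℝ) := Nat.cast_pos.2 Fintype.card_pos

/-- **Symmetrisation** over the hyperoctahedral group: `symAvg f x = |G|⁻¹ Σ_{(π,ε)} f(p(x;π,ε))`.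
[cite: FitznerVanDerHofstad2016NoBLE, Def. 2.5 (p. 1058)] -/
def symAvg (f : Site d → ℝ) (x : Site d) : ℝ :=
  (∑ g : SymParam d, f (Site.signedPerm g.1 g.2 x)) / Fintype.card (SymParam d)

/-- Unfolding lemma. [folklore] -/
theorem symAvg_apply (f : Site d → ℝ) (x : Site d) :
    symAvg f x = (∑ g : SymParam d, f (Site.signedPerm g.1 g.2 x)) / Fintype.card (SymParam d) := rfl

/-- The average is invariant under the group. [folklore] -/
theorem isZdSymmetric_symAvg (f : Site d → ℝ) : IsZdSymmetric (symAvg f) := by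
  intro π₀ ε₀ x
  simp only [symAvg_apply]
  congr 1
  refine Fintype.sum_equiv (symCompose (π₀, ε₀)) _ _ fun g => ?_
  rw [signedPerm_symCompose]

/-- The average is totally rotationally symmetric in the sense of [NoBLE17] Def. 2.5.
[cite: FitznerVanDerHofstad2016NoBLE, Def. 2.5 (p. 1058)] -/
theorem isTRS_symAvg (f : Site d → ℝ) : IsTRS (symAvg f) :=
  isTRS_iff_isZdSymmetric.2 (isZdSymmetric_symAvg f)

/-- A symmetric function is its own average. [folklore] -/
theorem symAvg_eq_self_of_isZdSymmetric {f : Site d → ℝ} (hf : IsZdSymmetric f) : symAvg f = f := by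
  funext x
  rw [symAvg_apply, Finset.sum_congr rfl fun g _ => hf g.1 g.2 x, Finset.sum_const, Finset.card_univ,
    nsmul_eq_mul, mul_div_cancel_left₀ _ card_symParam_pos.ne']

/-- Each translate of a summable function is summable. [folklore] -/
theorem summable_comp_signedPerm {f : Site d → ℝ} (hf : Summable f) (g : SymParam d) :
    Summable fun x => f (Site.signedPerm g.1 g.2 x) :=
  show Summable (f ∘ Site.signedPerm g.1 g.2) from (Equiv.summable_iff _).2 hf

/-- The average of a summable function is summable. [folklore] -/
theorem summable_symAvg {f : Site d → ℝ} (hf : Summable f) : Summable (symAvg f) :=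
  (summable_sum fun g _ => summable_comp_signedPerm hf g).div_const _

/-- **Convexity**: for an invariant weight `w ≥ 0` with `Σ w|f| < ∞`, the weighted `ℓ¹`-norm does not increase
under symmetrisation: `Σ_x w(x)|symAvg f(x)| ≤ Σ_x w(x)|f(x)|` (and the left family is summable). [folklore] -/
theorem symAvg_weighted_le {w f : Site d → ℝ} (hw : IsZdSymmetric w) (hw0 : ∀ x, 0 ≤ w x)
    (hs : Summable fun x => w x * |f x|) :
    Summable (fun x => w x * |symAvg f x|) ∧ ∑' x, w x * |symAvg f x| ≤ ∑' x, w x * |f x| := by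
  have hN := (card_symParam_pos (d := d))
  set N : ℝ := (Fintype.card (SymParam d) : ℝ) with hNdef
  have hpt : ∀ x, w x * |symAvg f x| ≤
      (∑ g : SymParam d, w (Site.signedPerm g.1 g.2 x) * |f (Site.signedPerm g.1 g.2 x)|) / N := by
    intro x
    rw [symAvg_apply, abs_div, abs_of_pos hN, ← mul_div_assoc]
    refine div_le_div_of_nonneg_right ?_ hN.le
    calc w x * |∑ g : SymParam d, f (Site.signedPerm g.1 g.2 x)|
        ≤ w x * ∑ g : SymParam d, |f (Site.signedPerm g.1 g.2 x)| :=
          mul_le_mul_of_nonneg_left (Finset.abs_sum_le_sum_abs _ _) (hw0 x)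
      _ = ∑ g : SymParam d, w (Site.signedPerm g.1 g.2 x) * |f (Site.signedPerm g.1 g.2 x)| := by
          rw [Finset.mul_sum]
          exact Finset.sum_congr rfl fun g _ => by rw [hw g.1 g.2 x]
  have hsg : ∀ g : SymParam d,
      Summable fun x => w (Site.signedPerm g.1 g.2 x) * |f (Site.signedPerm g.1 g.2 x)| := fun g =>
    show Summable ((fun y => w y * |f y|) ∘ Site.signedPerm g.1 g.2) from (Equiv.summable_iff _).2 hs
  have hsR : Summable fun x =>
      (∑ g : SymParam d, w (Site.signedPerm g.1 g.2 x) * |f (Site.signedPerm g.1 g.2 x)|) / N :=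
    (summable_sum fun g _ => hsg g).div_const N
  have hS : Summable fun x => w x * |symAvg f x| :=
    Summable.of_nonneg_of_le (fun x => mul_nonneg (hw0 x) (abs_nonneg _)) hpt hsR
  refine ⟨hS, (hS.tsum_le_tsum hpt hsR).trans (le_of_eq ?_)⟩
  rw [tsum_div_const, Summable.tsum_finsetSum (fun g _ => hsg g)]
  have hg : ∀ g : SymParam d,
      ∑' x, w (Site.signedPerm g.1 g.2 x) * |f (Site.signedPerm g.1 g.2 x)| = ∑' x, w x * |f x| :=
    fun g => Equiv.tsum_eq (Site.signedPerm g.1 g.2) (fun y => w y * |f y|)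
  rw [Finset.sum_congr rfl fun g _ => hg g, Finset.sum_const, Finset.card_univ, nsmul_eq_mul, ← hNdef,
    mul_div_cancel_left₀ _ hN.ne']

/-- `ℓ¹` case of `symAvg_weighted_le`: `Σ|symAvg f| ≤ Σ|f|`. [folklore] -/
theorem tsum_abs_symAvg_le {f : Site d → ℝ} (hf : Summable f) :
    ∑' x, |symAvg f x| ≤ ∑' x, |f x| := by
  have h := (symAvg_weighted_le (w := fun _ => (1 : ℝ)) (f := f) (fun _ _ _ => rfl) (fun _ => zero_le_one)
    (by simpa using hf.abs)).2
  simpa using h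

/-- `‖x‖₂²`-weighted case of `symAvg_weighted_le`. [folklore] -/
theorem normSq_symAvg_le {f : Site d → ℝ} (hs : Summable fun x => normSq x * |f x|) :
    Summable (fun x => normSq x * |symAvg f x|) ∧
      ∑' x, normSq x * |symAvg f x| ≤ ∑' x, normSq x * |f x| :=
  symAvg_weighted_le (fun π ε x => normSq_signedPerm π ε x) (fun x => normSq_nonneg x) hs

/-- **The cosine transform of the average** is the average of the transform over the dual action:
`(symAvg f)^(k) = |G|⁻¹ Σ_g f̂(kAct g k)`. [folklore] -/
theorem cosFT_symAvg {f : Site d → ℝ} (hf : Summable f) (k : Fin d → ℝ) :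
    cosFT (symAvg f) k = (∑ g : SymParam d, cosFT f (kAct g k)) / Fintype.card (SymParam d) := by
  have hsg : ∀ g : SymParam d,
      Summable fun x => Real.cos (kdot k x) * f (Site.signedPerm g.1 g.2 x) :=
    fun g => summable_cos_kdot_mul (summable_comp_signedPerm hf g) k
  rw [cosFT]
  simp only [symAvg_apply]
  calc ∑' x, Real.cos (kdot k x) * ((∑ g : SymParam d, f (Site.signedPerm g.1 g.2 x)) /
          Fintype.card (SymParam d))
      = ∑' x, (∑ g : SymParam d, Real.cos (kdot k x) * f (Site.signedPerm g.1 g.2 x)) /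
          Fintype.card (SymParam d) :=
        tsum_congr fun x => by rw [← mul_div_assoc, Finset.mul_sum]
    _ = (∑ g : SymParam d, ∑' x, Real.cos (kdot k x) * f (Site.signedPerm g.1 g.2 x)) /
          Fintype.card (SymParam d) := by
        rw [tsum_div_const, Summable.tsum_finsetSum (fun g _ => hsg g)]
    _ = (∑ g : SymParam d, cosFT f (kAct g k)) / Fintype.card (SymParam d) := by
        congr 1
        exact Finset.sum_congr rfl fun g _ => cosFT_comp_signedPerm f g k

/-- At `k = 0` the average has the same transform: `(symAvg f)^(0) = f̂(0)` (`= Σ_x f(x)`). [folklore] -/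
theorem cosFT_symAvg_zero {f : Site d → ℝ} (hf : Summable f) : cosFT (symAvg f) 0 = cosFT f 0 := by
  rw [cosFT_symAvg hf]
  simp only [kAct_zero, Finset.sum_const, Finset.card_univ, nsmul_eq_mul]
  rw [mul_div_cancel_left₀ _ card_symParam_pos.ne']

/-- The displacement difference of the average: `(symAvg f)^(0) − (symAvg f)^(k) = |G|⁻¹ Σ_g (f̂(0) − f̂(kAct g k))`.
[folklore] -/
theorem cosFT_symAvg_zero_sub {f : Site d → ℝ} (hf : Summable f) (k : Fin d → ℝ) :
    cosFT (symAvg f) 0 - cosFT (symAvg f) k =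
      (∑ g : SymParam d, (cosFT f 0 - cosFT f (kAct g k))) / Fintype.card (SymParam d) := by
  rw [cosFT_symAvg_zero hf, cosFT_symAvg hf, Finset.sum_sub_distrib, Finset.sum_const, Finset.card_univ,
    nsmul_eq_mul, sub_div, mul_div_cancel_left₀ _ card_symParam_pos.ne']

/-! ## C. The simplified form with symmetric remainders -/

/-- **The simplified NoBLE form with the complete Assumption 2.7 bounds AND totally rotationally symmetric
remainders**: verbatim `NobleSimplifiedFormF3At d p B E` with the two conjuncts `IsTRS R_Φ`, `IsTRS R_F`
([NoBLE17] Def. 2.5) prepended.  By `NobleSimplifiedFormF3At.symmetrise` below it is IMPLIED by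
`NobleSimplifiedFormF3At d p B E`; it is the form in which §3.3.4–3.3.5 use the remainders.
[cite: FitznerVanDerHofstad2016NoBLE, §1.3 (1.8) (p. 1045), Def. 2.5 (p. 1058), Assumption 2.7 (a)–(c) (pp. 1059–1060), Lemma 2.12 (p. 1063)] -/
def NobleSimplifiedFormF3SymAt (d : ℕ) (p : unitInterval) (B : NobleBeta) (E : NobleBetaF3) : Prop :=
  ∃ (cΦ αΦ cF αF ψ π lam : ℝ) (RΦ RF : Site d → ℝ), IsTRS RΦ ∧ IsTRS RF ∧ Summable RΦ ∧ Summable RF ∧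
    (∀ k ∈ cube d, tauHat d p k * (1 - (cF + αF * Dhat d k + cosFT RF k)) =
      cΦ + αΦ * Dhat d k + cosFT RΦ k) ∧
    nobleMu d p = (1 + π) * lam / (1 + ψ * (1 + lam)) ∧
    cF + αF + cosFT RF 0 = 2 * d * lam / (1 + lam) ∧ 0 ≤ lam ∧ (2 * d - 1) * lam < 1 ∧
    (p : ℝ) ≤ B.βμ * nobleMu d p ∧ 0 ≤ cΦ ∧ cΦ ≤ B.cΦup ∧ |αΦ| ≤ B.βαΦ ∧ B.αFlow ≤ αF ∧
    π ≤ B.βPi ∧ -B.βΨ ≤ ψ ∧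
    ∑' x, |RΦ x| ≤ B.βRΦ ∧
    (∀ k ∈ cube d, -(B.βΔ * (1 - Dhat d k)) ≤ cosFT RF 0 - cosFT RF k) ∧
    E.cΦlow ≤ cΦ ∧ αF ≤ E.αFup ∧
    ∑' x, |RF x| ≤ E.βRF ∧
    Summable (fun x => normSq x * |RΦ x|) ∧ ∑' x, normSq x * |RΦ x| ≤ E.βΔRΦ ∧
    Summable (fun x => normSq x * |RF x|) ∧ ∑' x, normSq x * |RF x| ≤ E.βΔRFabs

/-- Forgetting the symmetry. [folklore] -/
theorem NobleSimplifiedFormF3SymAt.toF3At {p : unitInterval} {B : NobleBeta} {E : NobleBetaF3}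
    (h : NobleSimplifiedFormF3SymAt d p B E) : NobleSimplifiedFormF3At d p B E := by
  obtain ⟨cΦ, αΦ, cF, αF, ψ, π, lam, RΦ, RF, -, -, hrest⟩ := h
  exact ⟨cΦ, αΦ, cF, αF, ψ, π, lam, RΦ, RF, hrest⟩

/-- **Symmetrisation of the witnesses.** Every instance of the extended simplified form has totally rotationally
symmetric remainders: replace `R_Φ, R_F` by their hyperoctahedral averages.  The `k`-space identity survives
because `τ̂_p` and `D̂` are invariant under the dual action and the identity is affine in `(R̂_Φ(k), R̂_F(k))`; the
bounds survive by convexity. [cite: FitznerVanDerHofstad2016NoBLE, Def. 2.5 (p. 1058); §1.3 (1.8) (p. 1045); Assumption 2.7 (pp. 1059–1060)] -/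
theorem NobleSimplifiedFormF3At.symmetrise {p : unitInterval} {B : NobleBeta} {E : NobleBetaF3}
    (h : NobleSimplifiedFormF3At d p B E) : NobleSimplifiedFormF3SymAt d p B E := by
  obtain ⟨cΦ, αΦ, cF, αF, ψ, π, lam, RΦ, RF, hRΦ, hRF, hform, hμ, hF0, hlam0, hlam1, hratio, hcΦ0,
    hcΦ, hαΦ, hαF, hπ, hψ, hRΦle, hRFb, hcΦlow, hαFup, hRFle, hsΦ, hΔΦ, hsF, hΔF⟩ := h
  have hN := (card_symParam_pos (d := d))
  set N : ℝ := (Fintype.card (SymParam d) : ℝ) with hNdef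
  refine ⟨cΦ, αΦ, cF, αF, ψ, π, lam, symAvg RΦ, symAvg RF, isTRS_symAvg RΦ, isTRS_symAvg RF,
    summable_symAvg hRΦ, summable_symAvg hRF, ?_, hμ, ?_, hlam0, hlam1, hratio, hcΦ0, hcΦ, hαΦ, hαF, hπ, hψ,
    (tsum_abs_symAvg_le hRΦ).trans hRΦle, ?_, hcΦlow, hαFup, (tsum_abs_symAvg_le hRF).trans hRFle,
    (normSq_symAvg_le hsΦ).1, ((normSq_symAvg_le hsΦ).2).trans hΔΦ,
    (normSq_symAvg_le hsF).1, ((normSq_symAvg_le hsF).2).trans hΔF⟩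
  · -- the `k`-space identity
    intro k hk
    have key : ∀ g : SymParam d, cosFT RΦ (kAct g k) =
        tauHat d p k * (1 - (cF + αF * Dhat d k)) - cΦ - αΦ * Dhat d k -
          tauHat d p k * cosFT RF (kAct g k) := fun g => by
      have h := hform (kAct g k) (kAct_mem_cube g hk)
      rw [tauHat_kAct, Dhat_kAct] at h
      linear_combination -h
    rw [cosFT_symAvg hRF, cosFT_symAvg hRΦ, Finset.sum_congr rfl fun g _ => key g, Finset.sum_sub_distrib,
      Finset.sum_sub_distrib, Finset.sum_sub_distrib, Finset.sum_const, Finset.sum_const, Finset.sum_const,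
      Finset.card_univ, ← Finset.mul_sum]
    simp only [nsmul_eq_mul, ← hNdef]
    field_simp
    ring
  · -- `F̂(0)` is unchanged
    rw [cosFT_symAvg_zero hRF, hF0]
  · -- the displacement lower bound
    intro k hk
    rw [cosFT_symAvg_zero_sub hRF, le_div_iff₀ hN]
    have hg : ∀ g ∈ (Finset.univ : Finset (SymParam d)),
        -(B.βΔ * (1 - Dhat d k)) ≤ cosFT RF 0 - cosFT RF (kAct g k) := fun g _ => by
      have h := hRFb (kAct g k) (kAct_mem_cube g hk)
      rwa [Dhat_kAct] at h
    have hsum := Finset.sum_le_sum hg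
    rw [Finset.sum_const, Finset.card_univ, nsmul_eq_mul, ← hNdef] at hsum
    linarith

/-- The symmetric form is thus EQUIVALENT to the extended form. [folklore] -/
theorem nobleSimplifiedFormF3SymAt_iff {p : unitInterval} {B : NobleBeta} {E : NobleBetaF3} :
    NobleSimplifiedFormF3SymAt d p B E ↔ NobleSimplifiedFormF3At d p B E :=
  ⟨NobleSimplifiedFormF3SymAt.toF3At, NobleSimplifiedFormF3At.symmetrise⟩

/-- The coefficient data with symmetry, extracted for the `f₃` analysis (cf.
`NobleSimplifiedFormF3At.exists_coefficients`): symmetric witnesses with `c̲_Φ ≤ c_Φ ≤ c̄_Φ`, `α̲_F ≤ α_F ≤ ᾱ_F`,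
`|α_Φ| ≤ β_{α,Φ}`, the four `ℓ¹`-type bounds, the displacement lower bound, the form identity, and the
`λ`-representation of `F̂(0)` (needed for `F̂(0) < 1`). [cite: FitznerVanDerHofstad2016NoBLE, Assumption 2.7 (a), (c) (pp. 1059–1060); Lemma 3.1] -/
theorem NobleSimplifiedFormF3At.exists_symmetric_coefficients {p : unitInterval} {B : NobleBeta}
    {E : NobleBetaF3} (h : NobleSimplifiedFormF3At d p B E) :
    ∃ (cΦ αΦ cF αF lam : ℝ) (RΦ RF : Site d → ℝ), IsTRS RΦ ∧ IsTRS RF ∧ Summable RΦ ∧ Summable RF ∧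
      (∀ k ∈ cube d, tauHat d p k * (1 - (cF + αF * Dhat d k + cosFT RF k)) =
        cΦ + αΦ * Dhat d k + cosFT RΦ k) ∧
      cF + αF + cosFT RF 0 = 2 * d * lam / (1 + lam) ∧ 0 ≤ lam ∧ (2 * d - 1) * lam < 1 ∧
      0 ≤ cΦ ∧ E.cΦlow ≤ cΦ ∧ cΦ ≤ B.cΦup ∧ |αΦ| ≤ B.βαΦ ∧ B.αFlow ≤ αF ∧ αF ≤ E.αFup ∧
      ∑' x, |RΦ x| ≤ B.βRΦ ∧ ∑' x, |RF x| ≤ E.βRF ∧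
      Summable (fun x => normSq x * |RΦ x|) ∧ ∑' x, normSq x * |RΦ x| ≤ E.βΔRΦ ∧
      Summable (fun x => normSq x * |RF x|) ∧ ∑' x, normSq x * |RF x| ≤ E.βΔRFabs ∧
      (∀ k ∈ cube d, -(B.βΔ * (1 - Dhat d k)) ≤ cosFT RF 0 - cosFT RF k) := by
  obtain ⟨cΦ, αΦ, cF, αF, ψ, π, lam, RΦ, RF, hTΦ, hTF, hRΦ, hRF, hform, -, hF0, hlam0, hlam1, -, hcΦ0,
    hcΦ, hαΦ, hαF, -, -, hRΦle, hRFb, hcΦlow, hαFup, hRFle, hsΦ, hΔΦ, hsF, hΔF⟩ := h.symmetrise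
  exact ⟨cΦ, αΦ, cF, αF, lam, RΦ, RF, hTΦ, hTF, hRΦ, hRF, hform, hF0, hlam0, hlam1, hcΦ0, hcΦlow, hcΦ, hαΦ,
    hαF, hαFup, hRΦle, hRFle, hsΦ, hΔΦ, hsF, hΔF, hRFb⟩

/-- **The interface consumed by the `f₃` analysis ([NoBLE17] §3.3.4–3.3.5).** From the extended simplified form
at `p < p_c` (`d ≥ 2`) with `f₂(p) ≤ Γ₂`, `0 < α̲_F` and the admissibility gap `β̲_Δ < α̲_F`: symmetric witnesses
`c_Φ, α_Φ, c_F, α_F, R_Φ, R_F` carrying all thirteen Assumption-2.7 bounds, such that at every `k ∈ [−π,π]^d`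
with `D̂(k) < 1` the atoms of `NobleLaplacianSplit` satisfy the key-quantity bounds `LapAtoms.KeyBounds` for the
arguments `NobleBetaF3.toArgs d B E Γ₂`, `τ̂_p(k) = Ĝ(k)` and `−Δτ̂_p(k) = Σ_{i=1}^5 Ĥ_i(k)`.
[cite: FitznerVanDerHofstad2016NoBLE, §3.3.4 (3.40)–(3.57), §3.3.5 (pp. 1072–1079); Assumption 2.7 (pp. 1059–1060)] -/
theorem NobleSimplifiedFormF3At.exists_keyBounds_and_split (hd : 2 ≤ d) {p : unitInterval}
    (hp : (p : ℝ) < criticalProb (zdGraph d) (0 : Site d)) {B : NobleBeta} {E : NobleBetaF3} {Γ₂ : ℝ}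
    (hΓ : nobleF2 d p ≤ Γ₂) (hαFlow : 0 < B.αFlow) (hgap : B.βΔ < B.αFlow)
    (h : NobleSimplifiedFormF3At d p B E) :
    ∃ (cΦ αΦ cF αF : ℝ) (RΦ RF : Site d → ℝ), IsTRS RΦ ∧ IsTRS RF ∧ Summable RΦ ∧ Summable RF ∧
      (∀ k ∈ cube d, tauHat d p k * (1 - (cF + αF * Dhat d k + cosFT RF k)) =
        cΦ + αΦ * Dhat d k + cosFT RΦ k) ∧
      cF + αF + cosFT RF 0 < 1 ∧
      0 ≤ cΦ ∧ E.cΦlow ≤ cΦ ∧ cΦ ≤ B.cΦup ∧ |αΦ| ≤ B.βαΦ ∧ B.αFlow ≤ αF ∧ αF ≤ E.αFup ∧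
      ∑' x, |RΦ x| ≤ B.βRΦ ∧ ∑' x, |RF x| ≤ E.βRF ∧
      Summable (fun x => normSq x * |RΦ x|) ∧ ∑' x, normSq x * |RΦ x| ≤ E.βΔRΦ ∧
      Summable (fun x => normSq x * |RF x|) ∧ ∑' x, normSq x * |RF x| ≤ E.βΔRFabs ∧
      (∀ k ∈ cube d, -(B.βΔ * (1 - Dhat d k)) ≤ cosFT RF 0 - cosFT RF k) ∧
      ∀ k ∈ cube d, Dhat d k < 1 →
        (lapAtomsAt d cΦ αΦ cF αF RΦ RF k).KeyBounds (NobleBetaF3.toArgs d B E Γ₂) ∧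
        tauHat d p k = (lapAtomsAt d cΦ αΦ cF αF RΦ RF k).G ∧
        tauWHat d p k = (lapAtomsAt d cΦ αΦ cF αF RΦ RF k).H1 + (lapAtomsAt d cΦ αΦ cF αF RΦ RF k).H2 +
          (lapAtomsAt d cΦ αΦ cF αF RΦ RF k).H3 + (lapAtomsAt d cΦ αΦ cF αF RΦ RF k).H4 +
          (lapAtomsAt d cΦ αΦ cF αF RΦ RF k).H5 := by
  obtain ⟨cΦ, αΦ, cF, αF, lam, RΦ, RF, hTΦ, hTF, hRΦ, hRF, hform, hF0, hlam0, hlam1, hcΦ0, hcΦlow, hcΦ, hαΦ,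
    hαF, hαFup, hRΦle, hRFle, hsΦ, hΔΦ, hsF, hΔF, hRFb⟩ := h.exists_symmetric_coefficients
  exact ⟨cΦ, αΦ, cF, αF, RΦ, RF, hTΦ, hTF, hRΦ, hRF, hform, F0_lt_one_of_lam hF0 hlam0 hlam1, hcΦ0, hcΦlow,
    hcΦ, hαΦ, hαF, hαFup, hRΦle, hRFle, hsΦ, hΔΦ, hsF, hΔF, hRFb, fun k hk hD =>
      keyBounds_and_split hd hp hΓ hRΦ hRF hTΦ hTF hform hF0 hlam0 hlam1 hcΦ0 hcΦ hαΦ hαF hαFup hRΦle hsΦ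
        hΔΦ hsF hΔF hRFb hαFlow hgap hk hD⟩


end Literature.Probability.FitznerVanDerHofstad2017
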